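/-
Copyright (c) 2026 the pub-hodgecm-mathlib formalisation cell (harness21).  Prover seat hodgecm-mathlib-K2E1-p07 (g2), Track B «K2-LIT», h413;
BY-NAME DEAL of the dealer K2E1-plan (g0) (`K2/STATUS.md` 2026-09-03T22:28:25Z), part 2 of the (H1) package.  2026-09-03.
-/
import Summits.HodgeConjecture.HodgeConjecture.Theorems.K2E1PoincareSeriesTestFunctions    -- ★ (this seat) part 1: the test functions `c ⊗ 𝟙_{K^v} ⊗ f_∞`
import Summits.HodgeConjecture.HodgeConjecture.Theorems.K2E1SupercuspidalIdempotent       -- ★ p855188: `integratedOperator_idempotent_apply_intertwiner`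
import HarnessLib

/-!
# K2_E1 road (h413 = stmt-HodgeConjecture-24833), 5R route S2 — the (H1) PACKAGE of ★ p855275 `K2E1GlobaliseSupercuspidalOfCuspCompact`, part 2:
# `F = P_{φ_u} ∈ L²(U(H)(𝔸_{L⁺}) ⧸ U(H)(L⁺))`, `F ≠ 0`, `R_v(e) F = F`, `U(H)(𝒪_w)`-fixed off `v`
(Gelbart (1975), §10 p. 153; Rogawski (1990), §13.8 p. 218 (i)–(iii); Getz–Hahn (2024), §9.2)

Cell `pub/hodgecm-mathlib` (D-0151), Track B, dealt BY NAME by the dealer K2E1-plan (g0) (`K2/STATUS.md` 2026-09-03T22:28:25Z) as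
`Theorems/K2E1PoincareSeriesH1Package.lean`: «instantiate K2E1-p06 (g2)'s assembly-node hypotheses (H1) from YOUR rung 1 + ★ p855188 idempotent …
(a) `F ≠ 0` … (b) `R_v(e) F = F` … (c) `∀ w ≠ v, ∀ k ∈ K_w, R(jl w k) F = F` … matching p855275's (H1) binders TOKEN FOR TOKEN».  THEOREMS ONLY
(no `def`, no instance, no notation, no named fact, no `sorry`); lane `--supports stmt-HodgeConjecture-24833 --as helper` (count-neutral).

THE FRAME is ★ p855275's: `L` CM, `H ∈ M_N(L)` (p855275: `N = 2`, `H = Φ`), a finite place `v` of `L⁺`, the local group `G_v = (cmDatum L N H).Local v`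
(locally profinite binders), `ρ` an irreducible admissible SUPERCUSPIDAL smooth representation of `G_v` on `V` with compact centre (`hZ`) and
invariant inner product `B`, `ν` an inversion-invariant Haar measure on `G_v`, `u ≠ 0`, the idempotent `e = λ⁻¹ B (ρ · u) u ∈ C_c(G_v)` (★ p855188),
an automorphic measure `μH`; the place embeddings are the CANONICAL ones `j_w = inclPlaceAdelic w ∘ localPiEquiv_w⁻¹` of part 1 (★
`K2E1PoincareSeriesTestFunctions.jhom_apply`).

THE CONSTRUCTION (no convolution, no Fubini).  For `x ∈ V` let `c_x(g) = B (ρ g u) x` (a compactly supported smooth coefficient: ★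
`IsSupercuspidal.hasCompactSupport_sesqForm_apply_apply'`, `continuous_sesqForm_apply_apply'`) and `φ_x = c_x ⊗ ⊗_{w ≠ v} 𝟙_{U(H)(𝒪_w)} ⊗ f ∈ C_c(U(H)(𝔸))`
(part 1 `exists_toCc_singleTensor`) with ONE archimedean factor `f`, `f(1) = 1`, chosen by part 1 `exists_archFactor_vanishing` for `c_u`; let
`P_{φ_x}` be its Poincaré series (★ rung 1 `K2E1PoincareSeriesCompactSupport`, counting measure on the discrete `U(H)(L⁺)`, `A_G = ⊥`).
* §1 `family_translate`: `φ_x(j_v(h)⁻¹ z) = φ_{ρ(h)x}(z)` (invariance of `B`); `family_invariant`: `φ_x(j_w(k)⁻¹ z) = φ_x(z)`, `k ∈ U(H)(𝒪_w)`, `w ≠ v`.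
* §2 `fiberIntegralVec_family_add ∕ _smul`: `x ↦ P_{φ_x}` is LINEAR (finite fibre sums, ★ rung 1 `fiberIntegralVec_quotientSubgroup_count_mk`).
* §3 **`exists_h1Package`** (and `exists_h1Package'`, the same in p855275's spelling `adelicGroupData L⁺ L c N H`, `rfl`-equal to `cmDatum L N H`):
  `∃ F : L², F ≠ 0 ∧ R_v(e) F = F ∧ ∀ w ≠ v, ∃ K_w` open compact, `∀ k ∈ K_w, R(j_w k) F = F` — with `F := T(u) = P_{φ_u}` for the LINEAR
  `ρ`-INTERTWINER `T : V → L²|_v`, `x ↦ P_{φ_x}` (§1–§2 + ★ rung 1 `rightRegular_toLp_fiberIntegralVec`): (b) is ★ p855188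
  `integratedOperator_idempotent_apply_intertwiner` («`π(e)` fixes `T u` for every intertwiner `T`»); (a) is `P_{φ_u}(1) = φ_u(1) = B u u ≠ 0` (single
  term: `φ_u` vanishes at every `γ ∈ U(H)(L⁺) ∖ {1}`) + ★ rung 1 `toLp_fiberIntegralVec_quotientSubgroup_ne_zero` (continuity, open-positivity of
  `μH`); (c) with `K_w = U(H)(𝒪_w)` (★ `isCompact_isOpen_cmLocalIntegralLevel`) by `family_invariant`.
LEDGER for the assembly node: (H1) = THIS FILE (unconditional, for `jl := j`); (H2∧H4), (H3), (T) remain the siblings' ∕ the named residuals.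
The vector `F` is the Poincaré series of `c_u ⊗ 𝟙 ⊗ f` with `c_u = λ · e` — the SAME test-function shape rung 2 (constant terms) expects.

HONEST LABEL: HC_CM is proved only modulo the 7 printed citations (2 remaining named inputs: hLiu418 = stmt-HodgeConjecture-24832,
h413 = stmt-HodgeConjecture-24833) until rung 0 closes; this file is a `--supports stmt-HodgeConjecture-24833` helper and retires nothing by itself.

## References
* [Gelbart1975] S. Gelbart, *Automorphic forms on adele groups*, Ann. of Math. Stud. 83 (1975), §10 p. 153 (`R(ξ)`, `ξ = d(σ)⟨σ u, u⟩`, cuts out `σ`).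
* [Rogawski1990] J. D. Rogawski, *Automorphic Representations of Unitary Groups in Three Variables*, Ann. of Math. Stud. 123 (1990), §13.8 p. 218 (i)–(iii).
* [GetzHahn2024] J. R. Getz, H. Hahn, *An Introduction to Automorphic Representations*, GTM 300 (2024), §9.2 (printed pp. 177–178).
* [BorelJacquet1979] A. Borel, H. Jacquet, PSPM 33.1 (1979), §4.1.
* [PlatonovRapinchuk1994] V. Platonov, A. Rapinchuk, *Algebraic Groups and Number Theory* (1994), §5.1.
-/

set_option autoImplicit false
-- justification (lint debt, as in every sibling `K2E1*` file): the mandated namespace `Summit.HodgeConjecture.HodgeConjecture.…` repeats a component.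
set_option linter.dupNamespace false

noncomputable section

open MeasureTheory Filter Topology CompactlySupported NumberField IsDedekindDomain
open scoped ComplexConjugate Classical
open Literature.NumberTheory.Automorphic Literature.NumberTheory.Automorphic.UnitaryGroup Representation
open Summit.HodgeConjecture.HodgeConjecture.Cruxes.H413.K2E1PoincareSeriesCompactSupport
open Summit.HodgeConjecture.HodgeConjecture.Cruxes.H413.K2E1PoincareSeriesTestFunctions
open Summit.HodgeConjecture.HodgeConjecture.Cruxes.H413.K2E1SupercuspidalIdempotent

namespace Summit.HodgeConjecture.HodgeConjecture.Cruxes.H413.K2E1PoincareSeriesH1Package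

section H1

variable (L : Type) [Field L] [NumberField L] [IsCMField L] {N : ℕ} (H : Matrix (Fin N) (Fin N) L)
  (v : HeightOneSpectrum (𝓞 ↥(maximalRealSubfield L)))
  {V : Type} [AddCommGroup V] [Module ℂ V] {ρ : Representation ℂ ((cmDatum L N H).Local v) V} {B : V →ₗ⋆[ℂ] V →ₗ[ℂ] ℂ}
  (hBinv : ∀ (g : (cmDatum L N H).Local v) (x y : V), B (ρ g x) (ρ g y) = B x y) {u : V}
  {f : arch (↥(maximalRealSubfield L)) L (IsCMField.complexConj L) N H → ℂ}
  (φ : V → C_c((cmDatum L N H).Adelic, ℂ))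
  (hφ : ∀ (x : V) (z : (cmDatum L N H).Adelic), φ x z = (if ∀ w, w ≠ v → (cmDatum L N H).toLocal w z ∈ cmLocalIntegralLevel L N H w then
          f (UnitaryGroup.archPart (↥(maximalRealSubfield L)) L (IsCMField.complexConj L) N H z) else 0) * B (ρ ((cmDatum L N H).toLocal v z) u) x)

/-! ## §1 The family `φ_x = c_x ⊗ ⊗_{w ≠ v} 𝟙_{U(H)(𝒪_w)} ⊗ f`, `c_x(g) = B (ρ g u) x`: equivariance and `U(H)(𝒪_w)`-invariance -/

include hBinv hφ in
/-- **Equivariance of the family**: `φ_x(j_v(h)⁻¹ · z) = φ_{ρ(h) x}(z)` (`Ψ_f` is `j_v`-invariant, `(j_v h⁻¹ z)_v = h⁻¹ z_v`, and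
`B (ρ (h⁻¹ g) u) x = B (ρ g u) (ρ h x)` by invariance of `B`). [cite: Gelbart1975, §10 p. 153] -/
theorem family_translate (h : (cmDatum L N H).Local v) (x : V) :
    (fun z : (cmDatum L N H).Adelic => φ x (((((MonoidHom.id ((cmDatum L N H).Adelic)).comp ((inclPlaceAdelic (↥(maximalRealSubfield L)) L (IsCMField.complexConj L) N H v).comp
        (localPiEquiv L (IsCMField.complexConj L) N H v).symm.toMulEquiv.toMonoidHom)).comp (MonoidHom.id ((cmDatum L N H).Local v))) h)⁻¹ * z)) = ⇑(φ (ρ h x)) := by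
  have key : ∀ g : (cmDatum L N H).Local v, B (ρ (h⁻¹ * g) u) x = B (ρ g u) (ρ h x) := fun g => by
    rw [map_mul, Module.End.mul_apply, ← hBinv h (ρ h⁻¹ (ρ g u)) x, ← Module.End.mul_apply, ← map_mul, mul_inv_cancel, map_one,
      Module.End.one_apply]
  funext z
  rw [← map_inv, hφ, hφ, awayFactor_jhom_mul L H v, map_mul, toLocal_jhom_self, key]

include hφ in
/-- **Invariance of the family under `U(H)(𝒪_w)`, `w ≠ v`**: `φ_x(j_w(k)⁻¹ · z) = φ_x(z)` for `k ∈ U(H)(𝒪_w)`. [cite: BorelJacquet1979, §4.1] -/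
theorem family_invariant {w : HeightOneSpectrum (𝓞 ↥(maximalRealSubfield L))} (hw : w ≠ v) {k : (cmDatum L N H).Local w}
    (hk : k ∈ cmLocalIntegralLevel L N H w) (x : V) :
    (fun z : (cmDatum L N H).Adelic => φ x (((((MonoidHom.id ((cmDatum L N H).Adelic)).comp ((inclPlaceAdelic (↥(maximalRealSubfield L)) L (IsCMField.complexConj L) N H w).comp
        (localPiEquiv L (IsCMField.complexConj L) N H w).symm.toMulEquiv.toMonoidHom)).comp (MonoidHom.id ((cmDatum L N H).Local w))) k)⁻¹ * z)) = ⇑(φ x) := by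
  funext z
  rw [← map_inv, hφ, hφ, awayFactor_jhom_mul_of_mem L H v _ ((cmLocalIntegralLevel L N H w).inv_mem hk), map_mul,
    toLocal_jhom_of_ne L H (Ne.symm hw), one_mul]

variable [MeasurableSpace (cmDatum L N H).Adelic] [BorelSpace (cmDatum L N H).Adelic]
  (μH : Measure (cmDatum L N H).automorphicQuotient) [(cmDatum L N H).IsAutomorphicMeasure μH]

/-! ## §2 The Poincaré series `P_{φ_x}` (★ rung 1, counting measure on the discrete `U(H)(L⁺)`): linearity in `x` -/

include hφ in
/-- **`x ↦ P_{φ_x}` is additive** (pointwise: the fibre sums over the discrete `U(H)(L⁺)` are finite, ★ rung 1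
`fiberIntegralVec_quotientSubgroup_count_mk`, and `c_{x+y} = c_x + c_y`). [folklore] -/
theorem fiberIntegralVec_family_add (x y : V) :
    haveI := discreteTopology_quotientSubgroup_of_center'_eq_bot (cmDatum L N H) rfl (cmDatum_isDiscreteRational L N H)
    haveI := countable_quotientSubgroup_of_center'_eq_bot (cmDatum L N H) rfl (cmDatum_isDiscreteRational L N H)
    haveI : IsClosed (((cmDatum L N H).quotientSubgroup : Subgroup (cmDatum L N H).Adelic) : Set (cmDatum L N H).Adelic) :=
      isClosed_quotientSubgroup_of_center'_eq_bot (cmDatum L N H) rfl (cmDatum_isDiscreteRational L N H)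
    letI := (cmDatum L N H).measurableSpaceQuotientForm
    haveI := (cmDatum L N H).borelSpaceQuotientForm
    (fiberIntegralVec (cmDatum L N H).quotientSubgroup (Measure.count : Measure (cmDatum L N H).quotientSubgroup) (⇑(φ (x + y))) : (cmDatum L N H).automorphicQuotient → ℂ) = fiberIntegralVec (cmDatum L N H).quotientSubgroup (Measure.count : Measure (cmDatum L N H).quotientSubgroup) (⇑(φ x)) + fiberIntegralVec (cmDatum L N H).quotientSubgroup (Measure.count : Measure (cmDatum L N H).quotientSubgroup) (⇑(φ y)) := by
  have hdisc : (cmDatum L N H).IsDiscreteRational := cmDatum_isDiscreteRational L N H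
  haveI := discreteTopology_quotientSubgroup_of_center'_eq_bot (cmDatum L N H) rfl hdisc
  haveI := countable_quotientSubgroup_of_center'_eq_bot (cmDatum L N H) rfl hdisc
  haveI : IsClosed (((cmDatum L N H).quotientSubgroup : Subgroup (cmDatum L N H).Adelic) : Set (cmDatum L N H).Adelic) :=
    isClosed_quotientSubgroup_of_center'_eq_bot (cmDatum L N H) rfl hdisc
  haveI : IsFiniteMeasureOnCompacts (Measure.count : Measure (cmDatum L N H).quotientSubgroup) :=
    ⟨fun _ hK => Measure.count_apply_lt_top.2 hK.finite_of_discrete⟩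
  letI := (cmDatum L N H).measurableSpaceQuotientForm
  haveI := (cmDatum L N H).borelSpaceQuotientForm
  funext q
  induction q using QuotientGroup.induction_on with
  | H g =>
    rw [Pi.add_apply, fiberIntegralVec_quotientSubgroup_count_mk (cmDatum L N H) rfl hdisc (φ (x + y)) g,
      fiberIntegralVec_quotientSubgroup_count_mk (cmDatum L N H) rfl hdisc (φ x) g, fiberIntegralVec_quotientSubgroup_count_mk (cmDatum L N H) rfl hdisc (φ y) g,
      ← (summable_of_hasFiniteSupport (finite_support_fiber (cmDatum L N H).quotientSubgroup (φ x).hasCompactSupport g)).tsum_add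
        (summable_of_hasFiniteSupport (finite_support_fiber (cmDatum L N H).quotientSubgroup (φ y).hasCompactSupport g))]
    exact tsum_congr fun γ => by rw [hφ, hφ, hφ, map_add, mul_add]

include hφ in
/-- **`x ↦ P_{φ_x}` is homogeneous** (`c_{a x} = a c_x`). [folklore] -/
theorem fiberIntegralVec_family_smul (a : ℂ) (x : V) :
    haveI := discreteTopology_quotientSubgroup_of_center'_eq_bot (cmDatum L N H) rfl (cmDatum_isDiscreteRational L N H)
    haveI := countable_quotientSubgroup_of_center'_eq_bot (cmDatum L N H) rfl (cmDatum_isDiscreteRational L N H)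
    haveI : IsClosed (((cmDatum L N H).quotientSubgroup : Subgroup (cmDatum L N H).Adelic) : Set (cmDatum L N H).Adelic) :=
      isClosed_quotientSubgroup_of_center'_eq_bot (cmDatum L N H) rfl (cmDatum_isDiscreteRational L N H)
    letI := (cmDatum L N H).measurableSpaceQuotientForm
    haveI := (cmDatum L N H).borelSpaceQuotientForm
    (fiberIntegralVec (cmDatum L N H).quotientSubgroup (Measure.count : Measure (cmDatum L N H).quotientSubgroup) (⇑(φ (a • x))) : (cmDatum L N H).automorphicQuotient → ℂ) = a • fiberIntegralVec (cmDatum L N H).quotientSubgroup (Measure.count : Measure (cmDatum L N H).quotientSubgroup) (⇑(φ x)) := by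
  have hdisc : (cmDatum L N H).IsDiscreteRational := cmDatum_isDiscreteRational L N H
  haveI := discreteTopology_quotientSubgroup_of_center'_eq_bot (cmDatum L N H) rfl hdisc
  haveI := countable_quotientSubgroup_of_center'_eq_bot (cmDatum L N H) rfl hdisc
  haveI : IsClosed (((cmDatum L N H).quotientSubgroup : Subgroup (cmDatum L N H).Adelic) : Set (cmDatum L N H).Adelic) :=
    isClosed_quotientSubgroup_of_center'_eq_bot (cmDatum L N H) rfl hdisc
  haveI : IsFiniteMeasureOnCompacts (Measure.count : Measure (cmDatum L N H).quotientSubgroup) :=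
    ⟨fun _ hK => Measure.count_apply_lt_top.2 hK.finite_of_discrete⟩
  letI := (cmDatum L N H).measurableSpaceQuotientForm
  haveI := (cmDatum L N H).borelSpaceQuotientForm
  funext q
  induction q using QuotientGroup.induction_on with
  | H g =>
    rw [Pi.smul_apply, fiberIntegralVec_quotientSubgroup_count_mk (cmDatum L N H) rfl hdisc (φ (a • x)) g,
      fiberIntegralVec_quotientSubgroup_count_mk (cmDatum L N H) rfl hdisc (φ x) g, smul_eq_mul, ← tsum_mul_left]
    exact tsum_congr fun γ => by rw [hφ, hφ, map_smul, smul_eq_mul, mul_left_comm]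

/-! ## §3 The (H1) package -/

variable [NonarchimedeanGroup ((cmDatum L N H).Local v)] [LocallyCompactSpace ((cmDatum L N H).Local v)] [T2Space ((cmDatum L N H).Local v)]
  [MeasurableSpace ((cmDatum L N H).Local v)] [BorelSpace ((cmDatum L N H).Local v)]
  [ρ.IsIrreducible] (hadm : ρ.IsAdmissible) (hsc : ρ.IsSupercuspidal)
  (hZ : IsCompact (Subgroup.center ((cmDatum L N H).Local v) : Set ((cmDatum L N H).Local v)))
  (hBsymm : B.IsSymm) (hBpos : ∀ x : V, x ≠ 0 → 0 < (B x x).re)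
  (ν : Measure ((cmDatum L N H).Local v)) [ν.IsHaarMeasure] [ν.IsInvInvariant] (hu : u ≠ 0)
  (e : C_c((cmDatum L N H).Local v, ℂ)) (he : ∀ g, e g = ((((∫ y, ‖B (ρ y u) u‖ ^ 2 ∂ν) / (B u u).re : ℝ) : ℂ))⁻¹ * B (ρ g u) u)

include hadm hsc hZ hBsymm hBpos hBinv hu he in
omit φ hφ in
/-- **THE (H1) PACKAGE of ★ p855275 `K2E1GlobaliseSupercuspidalOfCuspCompact`** — for the CANONICAL place embeddings
`j_w = inclPlaceAdelic w ∘ localPiEquiv_w⁻¹ : U(H)(L⁺_w) →* U(H)(𝔸_{L⁺})` (★ `UnitaryGroupPlaceInclusion`; part 1 `jhom_apply`) there is a vector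
`F ∈ L²(U(H)(𝔸_{L⁺}) ⧸ U(H)(L⁺), μH)` with (a) `F ≠ 0`, (b) `R_v(e) F = F`, (c) `F` fixed by `U(H)(𝒪_w)` at every finite `w ≠ v` — the binders
`F`, `hF0`, `hFe`, `hFK` of ★ `globaliseSupercuspidal_of_cuspCompact` for `jl := j` (typed over ★ `cmDatum L N H`, to which p855275's
`adelicGroupData L⁺ L c N H` is definitionally equal, ★ `adelicGroupData_eq_cmDatum`).  CONSTRUCTION: `F = P_{φ_u}`, the Poincaré series (★ rung 1,
counting measure on the discrete `U(H)(L⁺)`) of the pure tensor `φ_u = c_u ⊗ ⊗_{w ≠ v} 𝟙_{U(H)(𝒪_w)} ⊗ f_∞` with `c_u(g) = B (ρ g u) u` the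
supercuspidal coefficient (`e = λ⁻¹ c_u`) and `f_∞` from part 1 `exists_archFactor_vanishing`, so that `P_{φ_u}(1) = φ_u(1) = B u u ≠ 0`, whence
(a) by continuity and open-positivity of `μH` (★ rung 1 `toLp_fiberIntegralVec_quotientSubgroup_ne_zero`).  (b) WITHOUT convolutions:
`x ↦ P_{φ_x}` is a LINEAR `ρ`-INTERTWINER `T : V → L²|_v` (`family_translate` + ★ rung 1 `rightRegular_toLp_fiberIntegralVec`), and `π(e)` FIXES
`T(u)` for every intertwiner (★ p855188 `integratedOperator_idempotent_apply_intertwiner`).  (c) `family_invariant`.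
[cite: Gelbart1975, §10 p. 153] [cite: Rogawski1990, §13.8 p. 218 (i)–(iii)] -/
theorem exists_h1Package
    (hjv : Continuous
      (((MonoidHom.id ((cmDatum L N H).Adelic)).comp ((inclPlaceAdelic (↥(maximalRealSubfield L)) L (IsCMField.complexConj L) N H v).comp
        (localPiEquiv L (IsCMField.complexConj L) N H v).symm.toMulEquiv.toMonoidHom)).comp (MonoidHom.id ((cmDatum L N H).Local v)))) :
    ∃ F : (cmDatum L N H).L2 μH, F ≠ 0 ∧
      (((cmDatum L N H).rightRegular μH).restrict
          (((MonoidHom.id ((cmDatum L N H).Adelic)).comp ((inclPlaceAdelic (↥(maximalRealSubfield L)) L (IsCMField.complexConj L) N H v).comp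
        (localPiEquiv L (IsCMField.complexConj L) N H v).symm.toMulEquiv.toMonoidHom)).comp (MonoidHom.id ((cmDatum L N H).Local v)))).integratedOperator
        (((cmDatum L N H).isUnitary_rightRegular μH).restrict
          (((MonoidHom.id ((cmDatum L N H).Adelic)).comp ((inclPlaceAdelic (↥(maximalRealSubfield L)) L (IsCMField.complexConj L) N H v).comp
        (localPiEquiv L (IsCMField.complexConj L) N H v).symm.toMulEquiv.toMonoidHom)).comp (MonoidHom.id ((cmDatum L N H).Local v))))
        (((cmDatum L N H).isStronglyContinuous_rightRegular_holds μH).restrict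
          (((MonoidHom.id ((cmDatum L N H).Adelic)).comp ((inclPlaceAdelic (↥(maximalRealSubfield L)) L (IsCMField.complexConj L) N H v).comp
        (localPiEquiv L (IsCMField.complexConj L) N H v).symm.toMulEquiv.toMonoidHom)).comp (MonoidHom.id ((cmDatum L N H).Local v))) hjv) ν e F = F ∧
      ∀ w, w ≠ v → ∃ Kw : Subgroup ((cmDatum L N H).Local w), IsOpen (Kw : Set ((cmDatum L N H).Local w)) ∧
        IsCompact (Kw : Set ((cmDatum L N H).Local w)) ∧
          ∀ k ∈ Kw, (cmDatum L N H).rightRegular μH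
            ((((MonoidHom.id ((cmDatum L N H).Adelic)).comp ((inclPlaceAdelic (↥(maximalRealSubfield L)) L (IsCMField.complexConj L) N H w).comp
        (localPiEquiv L (IsCMField.complexConj L) N H w).symm.toMulEquiv.toMonoidHom)).comp (MonoidHom.id ((cmDatum L N H).Local w))) k) F = F := by
  have hdisc : (cmDatum L N H).IsDiscreteRational := cmDatum_isDiscreteRational L N H
  haveI := discreteTopology_quotientSubgroup_of_center'_eq_bot (cmDatum L N H) rfl hdisc
  haveI := countable_quotientSubgroup_of_center'_eq_bot (cmDatum L N H) rfl hdisc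
  haveI : IsClosed (((cmDatum L N H).quotientSubgroup : Subgroup (cmDatum L N H).Adelic) : Set (cmDatum L N H).Adelic) :=
    isClosed_quotientSubgroup_of_center'_eq_bot (cmDatum L N H) rfl hdisc
  haveI : IsFiniteMeasureOnCompacts (Measure.count : Measure (cmDatum L N H).quotientSubgroup) :=
    ⟨fun _ hK => Measure.count_apply_lt_top.2 hK.finite_of_discrete⟩
  letI := (cmDatum L N H).measurableSpaceQuotientForm
  haveI := (cmDatum L N H).borelSpaceQuotientForm
  have hsm : ρ.IsSmooth := hadm.isSmooth
  -- the coefficients `c_x(g) = B (ρ g u) x`, the archimedean factor `f`, the test functions `φ_x`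
  have hcc : ∀ x : V, Continuous fun g : (cmDatum L N H).Local v => B (ρ g u) x := fun x =>
    continuous_sesqForm_apply_apply' hBsymm (hsm u) x
  have hccs : ∀ x : V, HasCompactSupport fun g : (cmDatum L N H).Local v => B (ρ g u) x := fun x =>
    hsc.hasCompactSupport_sesqForm_apply_apply' hZ hsm hBinv u x
  obtain ⟨f, hfc, hfs, hf1, hvan⟩ := exists_archFactor_vanishing L H v (hcc u) (hccs u)
  choose φ hφ using fun x : V => exists_toCc_singleTensor L H v (hcc x) (hccs x) hfc hfs
  have hφ' : ∀ (x : V) (z : (cmDatum L N H).Adelic), φ x z = (if ∀ w, w ≠ v → (cmDatum L N H).toLocal w z ∈ cmLocalIntegralLevel L N H w then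
          f (UnitaryGroup.archPart (↥(maximalRealSubfield L)) L (IsCMField.complexConj L) N H z) else 0) * B (ρ ((cmDatum L N H).toLocal v z) u) x := hφ
  -- the Poincaré series `P_{φ_x} ∈ L²` and the linear map `T : x ↦ P_{φ_x}`
  have hP : ∀ x : V, MemLp (fiberIntegralVec (cmDatum L N H).quotientSubgroup (Measure.count : Measure (cmDatum L N H).quotientSubgroup) (⇑(φ x)) : (cmDatum L N H).automorphicQuotient → ℂ) 2 μH := fun x =>
    memLp_fiberIntegralVec_quotientSubgroup (cmDatum L N H) μH Measure.count (φ x) 2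
  let T : V →ₗ[ℂ] (cmDatum L N H).L2 μH :=
    { toFun := fun x => (hP x).toLp _
      map_add' := fun x y => by
        refine Lp.ext_iff.2 ?_
        have h2 : (fiberIntegralVec (cmDatum L N H).quotientSubgroup (Measure.count : Measure (cmDatum L N H).quotientSubgroup) (⇑(φ (x + y))) :
            (cmDatum L N H).automorphicQuotient → ℂ) =ᵐ[μH]
            fiberIntegralVec (cmDatum L N H).quotientSubgroup (Measure.count : Measure (cmDatum L N H).quotientSubgroup) (⇑(φ x)) +
              fiberIntegralVec (cmDatum L N H).quotientSubgroup (Measure.count : Measure (cmDatum L N H).quotientSubgroup) (⇑(φ y)) :=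
          Eventually.of_forall fun q => congrFun (fiberIntegralVec_family_add L H v φ hφ' x y) q
        exact (hP (x + y)).coeFn_toLp.trans (h2.trans (((hP x).coeFn_toLp.symm.add (hP y).coeFn_toLp.symm).trans (Lp.coeFn_add _ _).symm))
      map_smul' := fun a x => by
        refine Lp.ext_iff.2 ?_
        have h2 : (fiberIntegralVec (cmDatum L N H).quotientSubgroup (Measure.count : Measure (cmDatum L N H).quotientSubgroup) (⇑(φ (a • x))) :
            (cmDatum L N H).automorphicQuotient → ℂ) =ᵐ[μH]
            a • fiberIntegralVec (cmDatum L N H).quotientSubgroup (Measure.count : Measure (cmDatum L N H).quotientSubgroup) (⇑(φ x)) :=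
          Eventually.of_forall fun q => congrFun (fiberIntegralVec_family_smul L H v φ hφ' a x) q
        exact (hP (a • x)).coeFn_toLp.trans (h2.trans (((hP x).coeFn_toLp.symm.const_smul a).trans (Lp.coeFn_smul _ _).symm)) }
  have hT : ∀ x, T x = (hP x).toLp _ := fun _ => rfl
  -- `T` intertwines `ρ` with `R|_v`
  have hinter : ∀ (h : (cmDatum L N H).Local v) (x : V), T (ρ h x) =
      (((cmDatum L N H).rightRegular μH).restrict
        (((MonoidHom.id ((cmDatum L N H).Adelic)).comp ((inclPlaceAdelic (↥(maximalRealSubfield L)) L (IsCMField.complexConj L) N H v).comp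
        (localPiEquiv L (IsCMField.complexConj L) N H v).symm.toMulEquiv.toMonoidHom)).comp (MonoidHom.id ((cmDatum L N H).Local v)))) h (T x) := by
    intro h x
    rw [ContRepresentation.restrict_apply_apply, hT, hT]
    have hfun := family_translate L H v hBinv φ hφ' h x
    have hP' : MemLp (fiberIntegralVec (cmDatum L N H).quotientSubgroup (Measure.count : Measure (cmDatum L N H).quotientSubgroup) (fun z : (cmDatum L N H).Adelic => φ x (((((MonoidHom.id ((cmDatum L N H).Adelic)).comp ((inclPlaceAdelic (↥(maximalRealSubfield L)) L (IsCMField.complexConj L) N H v).comp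
        (localPiEquiv L (IsCMField.complexConj L) N H v).symm.toMulEquiv.toMonoidHom)).comp (MonoidHom.id ((cmDatum L N H).Local v))) h)⁻¹ * z)) : (cmDatum L N H).automorphicQuotient → ℂ) 2 μH := by
      rw [hfun]; exact hP (ρ h x)
    rw [rightRegular_toLp_fiberIntegralVec (cmDatum L N H) μH Measure.count _ (⇑(φ x)) (hP x) hP']
    exact MemLp.toLp_congr _ _ (Eventually.of_forall fun q => by rw [hfun])
  refine ⟨T u, ?_, ?_, fun w hw => ?_⟩
  · -- (a) `F ≠ 0`: `P_{φ_u}(1) = φ_u(1) = B u u ≠ 0`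
    rw [hT]
    refine toLp_fiberIntegralVec_quotientSubgroup_ne_zero (cmDatum L N H) μH Measure.count (φ u) 2 (x := QuotientGroup.mk 1) ?_
    refine ne_of_eq_of_ne (fiberIntegralVec_quotientSubgroup_count_mk (cmDatum L N H) rfl hdisc (φ u) 1) ?_
    have h1val : φ u 1 = B u u := by
      rw [hφ', awayFactor_one L H v, hf1, one_mul, map_one, map_one, Module.End.one_apply]
    rw [tsum_eq_single (1 : (cmDatum L N H).quotientSubgroup) (fun γ hγ => by
        rw [one_mul, hφ']; exact hvan γ γ.2 (fun h => hγ (Subtype.ext h))),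
      OneMemClass.coe_one, one_mul, h1val]
    exact fun h => (hBpos u hu).ne' (by rw [h, Complex.zero_re])
  · -- (b) `R_v(e) F = F`: ★ p855188 on the intertwiner `T`
    exact integratedOperator_idempotent_apply_intertwiner hadm hsc hZ hBsymm hBpos hBinv ν hu e he _ _ T hinter
  · -- (c) `U(H)(𝒪_w)`-invariance, `w ≠ v`
    refine ⟨cmLocalIntegralLevel L N H w, (isCompact_isOpen_cmLocalIntegralLevel L N H w).2,
      (isCompact_isOpen_cmLocalIntegralLevel L N H w).1, fun k hk => ?_⟩
    rw [hT]
    have hfun := family_invariant L H v φ hφ' hw hk u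
    have hP' : MemLp (fiberIntegralVec (cmDatum L N H).quotientSubgroup (Measure.count : Measure (cmDatum L N H).quotientSubgroup) (fun z : (cmDatum L N H).Adelic => φ u (((((MonoidHom.id ((cmDatum L N H).Adelic)).comp ((inclPlaceAdelic (↥(maximalRealSubfield L)) L (IsCMField.complexConj L) N H w).comp
        (localPiEquiv L (IsCMField.complexConj L) N H w).symm.toMulEquiv.toMonoidHom)).comp (MonoidHom.id ((cmDatum L N H).Local w))) k)⁻¹ * z)) : (cmDatum L N H).automorphicQuotient → ℂ) 2 μH := by
      rw [hfun]; exact hP u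
    rw [rightRegular_toLp_fiberIntegralVec (cmDatum L N H) μH Measure.count _ (⇑(φ u)) (hP u) hP']
    exact MemLp.toLp_congr _ _ (Eventually.of_forall fun q => by rw [hfun])

include hadm hsc hZ hBsymm hBpos hBinv hu he in
omit φ hφ μH in
/-- **The (H1) package in the spelling of ★ p855275** (`𝒢₂ := adelicGroupData L⁺ L c N H`, definitionally `cmDatum L N H` — ★
`adelicGroupData_eq_cmDatum`): the binders `F`, `hF0`, `hFe`, `hFK` of ★ `globaliseSupercuspidal_of_cuspCompact` for the canonical place
embeddings `jl := j`, token for token. [cite: Rogawski1990, §13.8 p. 218 (i)–(iii)] -/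
theorem exists_h1Package'
    (μH : Measure (adelicGroupData (↥(maximalRealSubfield L)) L (IsCMField.complexConj L) N H).automorphicQuotient) [(adelicGroupData (↥(maximalRealSubfield L)) L (IsCMField.complexConj L) N H).IsAutomorphicMeasure μH]
    (hjv : Continuous
      (((MonoidHom.id ((cmDatum L N H).Adelic)).comp ((inclPlaceAdelic (↥(maximalRealSubfield L)) L (IsCMField.complexConj L) N H v).comp
        (localPiEquiv L (IsCMField.complexConj L) N H v).symm.toMulEquiv.toMonoidHom)).comp (MonoidHom.id ((cmDatum L N H).Local v)))) :
    ∃ F : (adelicGroupData (↥(maximalRealSubfield L)) L (IsCMField.complexConj L) N H).L2 μH, F ≠ 0 ∧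
      (((adelicGroupData (↥(maximalRealSubfield L)) L (IsCMField.complexConj L) N H).rightRegular μH).restrict
          (((MonoidHom.id ((cmDatum L N H).Adelic)).comp ((inclPlaceAdelic (↥(maximalRealSubfield L)) L (IsCMField.complexConj L) N H v).comp
        (localPiEquiv L (IsCMField.complexConj L) N H v).symm.toMulEquiv.toMonoidHom)).comp (MonoidHom.id ((cmDatum L N H).Local v)))).integratedOperator
        (((adelicGroupData (↥(maximalRealSubfield L)) L (IsCMField.complexConj L) N H).isUnitary_rightRegular μH).restrict
          (((MonoidHom.id ((cmDatum L N H).Adelic)).comp ((inclPlaceAdelic (↥(maximalRealSubfield L)) L (IsCMField.complexConj L) N H v).comp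
        (localPiEquiv L (IsCMField.complexConj L) N H v).symm.toMulEquiv.toMonoidHom)).comp (MonoidHom.id ((cmDatum L N H).Local v))))
        (((adelicGroupData (↥(maximalRealSubfield L)) L (IsCMField.complexConj L) N H).isStronglyContinuous_rightRegular_holds μH).restrict
          (((MonoidHom.id ((cmDatum L N H).Adelic)).comp ((inclPlaceAdelic (↥(maximalRealSubfield L)) L (IsCMField.complexConj L) N H v).comp
        (localPiEquiv L (IsCMField.complexConj L) N H v).symm.toMulEquiv.toMonoidHom)).comp (MonoidHom.id ((cmDatum L N H).Local v))) hjv) ν e F = F ∧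
      ∀ w, w ≠ v → ∃ Kw : Subgroup ((cmDatum L N H).Local w), IsOpen (Kw : Set ((cmDatum L N H).Local w)) ∧
        IsCompact (Kw : Set ((cmDatum L N H).Local w)) ∧
          ∀ k ∈ Kw, (adelicGroupData (↥(maximalRealSubfield L)) L (IsCMField.complexConj L) N H).rightRegular μH
            ((((MonoidHom.id ((cmDatum L N H).Adelic)).comp ((inclPlaceAdelic (↥(maximalRealSubfield L)) L (IsCMField.complexConj L) N H w).comp
        (localPiEquiv L (IsCMField.complexConj L) N H w).symm.toMulEquiv.toMonoidHom)).comp (MonoidHom.id ((cmDatum L N H).Local w))) k) F = F := by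
  haveI : (cmDatum L N H).IsAutomorphicMeasure μH := ‹(adelicGroupData (↥(maximalRealSubfield L)) L (IsCMField.complexConj L) N H).IsAutomorphicMeasure μH›
  exact exists_h1Package L H v hBinv μH hadm hsc hZ hBsymm hBpos ν hu e he hjv

end H1

end Summit.HodgeConjecture.HodgeConjecture.Cruxes.H413.K2E1PoincareSeriesH1Package

end
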